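import Summits.Ventures.CertifiedManyBodySolver.Observables.TIGroundStatePairLROCeilingHolds
import Literature.MathematicalPhysics.QuantumLattice.MeanEnergyMinimiserConjugateInterval
import Literature.MathematicalPhysics.QuantumLattice.DWaveOrderParameterQuasiAverageState
import Summits.Ventures.CertifiedManyBodySolver.Observables.TorusPairLROFixedSourceTTPrime

/-!
# The finite-`h` pair-LRO BAND of translation-invariant sourced ground states (transplant-1 §12, r1):
# floor ∧ ceiling packaged, the own-amplitude floor, the top state clusters, and the kink reading

Cell `hubbard-cq` (venture `CertifiedManyBodySolver`; seat hubbard-cq-p4, KT dictionary (44) §12 residual r1;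
lead RULING 121/126 «r1 is p4's»). Inputs BY NAME: the floor (F) `sq_half_leftDeriv_le_re_boxAverage_dWavePairCorr`
(hubbard-cq-p5, `SourcedGroundStatePairLROFloor.lean`), the discharged ceiling `tiGroundStatePairLROCeiling_holds`
(hubbard-cq-p3, `TIGroundStatePairLROCeilingHolds.lean`), the state's own Cauchy–Schwarz floor
`IsTranslationInvariant.re_expect_localPairAt_sq_le_re_boxAverage_dWavePairCorr` (hubbard-cq-p4,
`TranslationInvariantStatePairLRO.lean`), the Griffiths range / attained top amplitude
(`DWaveOrderParameterInfiniteVolume.lean` §3) and the interval theorem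
(`MeanEnergyMinimiserConjugateInterval.lean`). Notation: `E = dWaveSourceEnergyDensityTT' t' U μ`,
`Ψ_h = hubbardTTPrimeSourcedInteraction 1 t' U μ dWaveFormFactor h`, `a(ω) = Re ω(P₀^d)`,
`boxLRO_N(ω) = Re N⁻⁴ Σ_{x,y∈[0,N)²} ω(P_x^d⋆P_y^d)`.

* `eventually_boxLRO_mem_Icc` — **THE BAND at `h > 0`**: every TI ground state `ω` of `Ψ_h` has, `∀ ε > 0`,
  eventually `(∂⁻E(h)/2)² ≤ boxLRO_N(ω) ≤ (∂⁺E(h)/2)² + ε`.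
* `eventually_sq_amplitude_le_boxLRO_le` — every `h ≥ 0`: eventually `a(ω)² ≤ boxLRO_N(ω) ≤ (∂⁺E(h)/2)² + ε`
  (the state's OWN amplitude floors its LRO; `a(ω) ∈ [−∂⁻E(h)/2, −∂⁺E(h)/2]`).
* `tendsto_boxLRO_of_amplitude_eq_top` — **THE TOP STATE CLUSTERS** (every `h ≥ 0`): a TI ground state with the
  LARGEST amplitude `a(ω) = −∂⁺E(h)/2` has `boxLRO_N(ω) → (∂⁺E(h)/2)²`; such a state exists
  (`exists_isMeanEnergyMinimiser_tendsto_boxLRO_top`). At `h = 0`: every TI ground state with `a(ω) = m⋆`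
  (Koma–Tasaki's quasi-average state) has box `d`-wave ODLRO converging to EXACTLY `(m⋆)²`
  (`tendsto_boxLRO_of_re_expect_eq_dWaveOrderParameterTT'`).
* `sq_dWaveOrderParameterTT'_le_boxLRO` — `(m⋆)² ≤ boxLRO_N(ω)` for EVERY TI ground state of `Ψ_h`, every
  `h > 0`, every `N ≥ 1` (F + p6's `m⋆ ≤ −∂⁻E(h)/2`); `exists_forall_eventually_boxLRO_mem_Icc_sq_dWaveOrderParameterTT'`
  — THE INFINITE-VOLUME QUASI-AVERAGE IDENTITY `lim_{h→0⁺} lim_N boxLRO_N = (m⋆)²` uniformly over sourced ground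
  states; `odlro_of_hasDWaveOrderTT'` (`m⋆ > 0` ⇒ every TI GS at small `h > 0` has ODLRO `≥ (m⋆)²`).
* `kink_band` — **THE KINK READING** (`h > 0`, `∂⁺E(h) < ∂⁻E(h)`): the amplitudes of the TI ground states fill
  `[−∂⁻E/2, −∂⁺E/2]` (interval theorem), every one of them has its LRO eventually in
  `[max((∂⁻E/2)², a(ω)²), (∂⁺E/2)² + ε]`, and the top state's LRO tends to `(∂⁺E/2)²`; nothing more is claimed
  for the others (a first-order line in the field: coexisting phases, LRO of a mixture is not determined by `a`).

HONEST SCOPE: T5-class statements about INFINITE-VOLUME translation-invariant ground states; no torus, no number,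
no instrument; a kink at `h > 0` is neither asserted nor excluded. Everything PROVED; 0 defs; zero compute.

References: R. B. Griffiths, Phys. Rev. 152 (1966) 240, §II [cite: Griffiths1966, §II]; T. Koma, H. Tasaki,
Commun. Math. Phys. 158 (1993) 191, Thm 7.3 [cite: KomaTasaki1993, Theorem 7.3]; J. Stat. Phys. 76 (1994) 745, §1
[cite: KomaTasaki1994, §1].
-/

noncomputable section

namespace Summit.Ventures.CertifiedManyBodySolver.Observables.TIGroundStatePairLROBand

open Matrix Finset Filter Topology Set Literature.MathematicalPhysics.QuantumLattice
open Literature.Probability.LatticeModels HubbardWave0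
open Summit.Ventures.CertifiedManyBodySolver.Observables.SourcedTorusAHM
open scoped ComplexOrder

variable {t' U μ h : ℝ} {ω : InfVolFermionState 2}

/-- **THE BAND at `h > 0`**: for every translation-invariant ground state `ω` of `Ψ_h` and every `ε > 0`,
eventually in `N`: `(∂⁻E(h)/2)² ≤ boxLRO_N(ω) ≤ (∂⁺E(h)/2)² + ε` (floor (F) for all `N ≥ 1`, ceiling (C)
eventually). [cite: Griffiths1966, §II] [cite: KomaTasaki1993, Theorem 7.3] -/
theorem eventually_boxLRO_mem_Icc (hh : 0 < h)
    (hω : ω.IsMeanEnergyMinimiser (hubbardTTPrimeSourcedInteraction 1 t' U μ dWaveFormFactor h) 1)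
    {ε : ℝ} (hε : 0 < ε) :
    ∀ᶠ N : ℕ in atTop,
      (((N : ℂ) ^ 4)⁻¹ * ∑ x ∈ halfOpenBox 2 N, ∑ y ∈ halfOpenBox 2 N, ω.dWavePairCorr x y).re ∈
        Set.Icc ((derivWithin (dWaveSourceEnergyDensityTT' t' U μ) (Iio h) h / 2) ^ 2)
          ((derivWithin (dWaveSourceEnergyDensityTT' t' U μ) (Ioi h) h / 2) ^ 2 + ε) := by
  filter_upwards [tiGroundStatePairLROCeiling_holds t' U μ hh.le hω ε hε, eventually_ne_atTop 0] with N hC hN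
  exact ⟨hω.sq_half_leftDeriv_le_re_boxAverage_dWavePairCorr hh hN, hC⟩

/-- **Every `h ≥ 0`: the state's OWN amplitude floors its LRO, the response ceils it**: eventually
`(Re ω(P₀^d))² ≤ boxLRO_N(ω) ≤ (∂⁺E(h)/2)² + ε`. [cite: KomaTasaki1993, Theorem 7.3] -/
theorem eventually_sq_amplitude_le_boxLRO_le (hh : 0 ≤ h)
    (hω : ω.IsMeanEnergyMinimiser (hubbardTTPrimeSourcedInteraction 1 t' U μ dWaveFormFactor h) 1)
    {ε : ℝ} (hε : 0 < ε) :
    ∀ᶠ N : ℕ in atTop,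
      (ω.expect (pairRegion (insert (0 : Site 2) unitSteps) 0)
          (localPairAt (insert 0 unitSteps) dWaveFormFactor 0)).re ^ 2 ≤
        (((N : ℂ) ^ 4)⁻¹ * ∑ x ∈ halfOpenBox 2 N, ∑ y ∈ halfOpenBox 2 N, ω.dWavePairCorr x y).re ∧
      (((N : ℂ) ^ 4)⁻¹ * ∑ x ∈ halfOpenBox 2 N, ∑ y ∈ halfOpenBox 2 N, ω.dWavePairCorr x y).re ≤
        (derivWithin (dWaveSourceEnergyDensityTT' t' U μ) (Ioi h) h / 2) ^ 2 + ε := by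
  filter_upwards [tiGroundStatePairLROCeiling_holds t' U μ hh hω ε hε, eventually_ne_atTop 0] with N hC hN
  exact ⟨hω.1.re_expect_localPairAt_sq_le_re_boxAverage_dWavePairCorr hN, hC⟩

/-- **THE TOP STATE CLUSTERS** (every `h ≥ 0`): a translation-invariant ground state of `Ψ_h` whose amplitude is
the LARGEST one, `2 Re ω(P₀^d) = −∂⁺E(h)`, has `boxLRO_N(ω) → (∂⁺E(h)/2)²` — its pair LRO is exactly its amplitude
squared (Cauchy–Schwarz below, the ceiling above). [cite: KomaTasaki1993, Theorem 7.3] -/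
theorem tendsto_boxLRO_of_amplitude_eq_top (hh : 0 ≤ h)
    (hω : ω.IsMeanEnergyMinimiser (hubbardTTPrimeSourcedInteraction 1 t' U μ dWaveFormFactor h) 1)
    (htop : 2 * (ω.expect (pairRegion (insert (0 : Site 2) unitSteps) 0)
        (localPairAt (insert 0 unitSteps) dWaveFormFactor 0)).re =
      -derivWithin (dWaveSourceEnergyDensityTT' t' U μ) (Ioi h) h) :
    Tendsto (fun N : ℕ =>
        (((N : ℂ) ^ 4)⁻¹ * ∑ x ∈ halfOpenBox 2 N, ∑ y ∈ halfOpenBox 2 N, ω.dWavePairCorr x y).re) atTop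
      (𝓝 ((derivWithin (dWaveSourceEnergyDensityTT' t' U μ) (Ioi h) h / 2) ^ 2)) := by
  set D := derivWithin (dWaveSourceEnergyDensityTT' t' U μ) (Ioi h) h with hD
  have hsq : (ω.expect (pairRegion (insert (0 : Site 2) unitSteps) 0)
      (localPairAt (insert 0 unitSteps) dWaveFormFactor 0)).re ^ 2 = (D / 2) ^ 2 := by
    have : (ω.expect (pairRegion (insert (0 : Site 2) unitSteps) 0)
        (localPairAt (insert 0 unitSteps) dWaveFormFactor 0)).re = -D / 2 := by linarith
    rw [this]; ring
  rw [Metric.tendsto_atTop]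
  intro ε hε
  obtain ⟨J, hJ⟩ := eventually_atTop.1 (eventually_sq_amplitude_le_boxLRO_le hh hω (half_pos hε))
  refine ⟨J, fun N hN => ?_⟩
  obtain ⟨hlo, hhi⟩ := hJ N hN
  rw [hsq] at hlo
  rw [Real.dist_eq, abs_lt]
  constructor <;> linarith

/-- **Such a top state exists at every `h ≥ 0`**: some translation-invariant ground state of `Ψ_h` has
`boxLRO_N(ω) → (∂⁺E(h)/2)²`. [cite: KomaTasaki1994, §1] -/
theorem exists_isMeanEnergyMinimiser_tendsto_boxLRO_top (t' U μ : ℝ) (hh : 0 ≤ h) :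
    ∃ ω : InfVolFermionState 2,
      ω.IsMeanEnergyMinimiser (hubbardTTPrimeSourcedInteraction 1 t' U μ dWaveFormFactor h) 1 ∧
      Tendsto (fun N : ℕ =>
          (((N : ℂ) ^ 4)⁻¹ * ∑ x ∈ halfOpenBox 2 N, ∑ y ∈ halfOpenBox 2 N, ω.dWavePairCorr x y).re) atTop
        (𝓝 ((derivWithin (dWaveSourceEnergyDensityTT' t' U μ) (Ioi h) h / 2) ^ 2)) := by
  obtain ⟨ω, hω, htop⟩ := exists_isMeanEnergyMinimiser_two_mul_re_expect_localPairAt_eq_neg_rightDeriv t' U μ h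
  exact ⟨ω, hω, tendsto_boxLRO_of_amplitude_eq_top hh hω htop⟩

/-- **At `h = 0`: every translation-invariant ground state of the grand-canonical `t–t'` Hubbard interaction whose
REAL pair amplitude is the order parameter, `Re ω(P₀^d) = m⋆` (Koma–Tasaki's quasi-average state), has box
`d`-wave ODLRO converging to EXACTLY `(m⋆)²`.** [cite: KomaTasaki1994, §1] [cite: KomaTasaki1993, Theorem 7.3] -/
theorem tendsto_boxLRO_of_re_expect_eq_dWaveOrderParameterTT' {t' U μ : ℝ} {ω : InfVolFermionState 2}
    (hω : ω.IsMeanEnergyMinimiser (hubbardTTPrimeMuInteraction 1 t' U μ) 1)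
    (hamp : (ω.expect (pairRegion (insert (0 : Site 2) unitSteps) 0)
        (localPairAt (insert 0 unitSteps) dWaveFormFactor 0)).re = dWaveOrderParameterTT' t' U μ) :
    Tendsto (fun N : ℕ =>
        (((N : ℂ) ^ 4)⁻¹ * ∑ x ∈ halfOpenBox 2 N, ∑ y ∈ halfOpenBox 2 N, ω.dWavePairCorr x y).re) atTop
      (𝓝 (dWaveOrderParameterTT' t' U μ ^ 2)) := by
  have hω' : ω.IsMeanEnergyMinimiser (hubbardTTPrimeSourcedInteraction 1 t' U μ dWaveFormFactor 0) 1 := by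
    rwa [hubbardTTPrimeSourcedInteraction_zero_source]
  have htop : 2 * (ω.expect (pairRegion (insert (0 : Site 2) unitSteps) 0)
      (localPairAt (insert 0 unitSteps) dWaveFormFactor 0)).re =
      -derivWithin (dWaveSourceEnergyDensityTT' t' U μ) (Ioi 0) 0 := by
    rw [hamp, dWaveOrderParameterTT'_eq_neg_half_rightDeriv]; ring
  have h := tendsto_boxLRO_of_amplitude_eq_top le_rfl hω' htop
  have e : (derivWithin (dWaveSourceEnergyDensityTT' t' U μ) (Ioi 0) 0 / 2) ^ 2 =
      dWaveOrderParameterTT' t' U μ ^ 2 := by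
    rw [dWaveOrderParameterTT'_eq_neg_half_rightDeriv]; ring
  rwa [e] at h

/-- **THE KINK READING** (`h > 0`): the amplitudes of the translation-invariant ground states of `Ψ_h` fill
EXACTLY `[−∂⁻E(h)/2, −∂⁺E(h)/2]` (hubbard-cq-p4's interval theorem), EVERY one of them has its box pair LRO
eventually in `[max((∂⁻E(h)/2)², a(ω)²), (∂⁺E(h)/2)² + ε]`, and the top one (`a = −∂⁺E/2`) has LRO `→ (∂⁺E/2)²`.
(At a kink `∂⁺E(h) < ∂⁻E(h)` — a first-order line in the field — this is all the dictionary says: the LRO of a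
mixture of coexisting phases is not a function of its amplitude.) [cite: Griffiths1966, §II] -/
theorem kink_band (t' U μ : ℝ) (hh : 0 < h) :
    ((fun ω : InfVolFermionState 2 => (ω.expect (pairRegion (insert (0 : Site 2) unitSteps) 0)
        (localPairAt (insert 0 unitSteps) dWaveFormFactor 0)).re) ''
        {ω | ω.IsMeanEnergyMinimiser (hubbardTTPrimeSourcedInteraction 1 t' U μ dWaveFormFactor h) 1} =
      Set.Icc (-derivWithin (dWaveSourceEnergyDensityTT' t' U μ) (Iio h) h / 2)
        (-derivWithin (dWaveSourceEnergyDensityTT' t' U μ) (Ioi h) h / 2)) ∧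
    (∀ ⦃ω : InfVolFermionState 2⦄,
      ω.IsMeanEnergyMinimiser (hubbardTTPrimeSourcedInteraction 1 t' U μ dWaveFormFactor h) 1 →
      ∀ ε : ℝ, 0 < ε → ∀ᶠ N : ℕ in atTop,
        max ((derivWithin (dWaveSourceEnergyDensityTT' t' U μ) (Iio h) h / 2) ^ 2)
            ((ω.expect (pairRegion (insert (0 : Site 2) unitSteps) 0)
              (localPairAt (insert 0 unitSteps) dWaveFormFactor 0)).re ^ 2) ≤
          (((N : ℂ) ^ 4)⁻¹ * ∑ x ∈ halfOpenBox 2 N, ∑ y ∈ halfOpenBox 2 N, ω.dWavePairCorr x y).re ∧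
        (((N : ℂ) ^ 4)⁻¹ * ∑ x ∈ halfOpenBox 2 N, ∑ y ∈ halfOpenBox 2 N, ω.dWavePairCorr x y).re ≤
          (derivWithin (dWaveSourceEnergyDensityTT' t' U μ) (Ioi h) h / 2) ^ 2 + ε) ∧
    (∃ ω : InfVolFermionState 2,
      ω.IsMeanEnergyMinimiser (hubbardTTPrimeSourcedInteraction 1 t' U μ dWaveFormFactor h) 1 ∧
      Tendsto (fun N : ℕ =>
          (((N : ℂ) ^ 4)⁻¹ * ∑ x ∈ halfOpenBox 2 N, ∑ y ∈ halfOpenBox 2 N, ω.dWavePairCorr x y).re) atTop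
        (𝓝 ((derivWithin (dWaveSourceEnergyDensityTT' t' U μ) (Ioi h) h / 2) ^ 2))) := by
  refine ⟨image_re_expect_localPairAt_minimisers_eq_Icc t' U μ h, fun ω hω ε hε => ?_,
    exists_isMeanEnergyMinimiser_tendsto_boxLRO_top t' U μ hh.le⟩
  filter_upwards [eventually_boxLRO_mem_Icc hh hω hε, eventually_sq_amplitude_le_boxLRO_le hh.le hω hε]
    with N h1 h2
  exact ⟨max_le h1.1 h2.1, h1.2⟩

/-! ### The zero-field order parameter floors the LRO of EVERY sourced ground state; the infinite-volume
quasi-average identity -/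

/-- **`(m⋆)² ≤ boxLRO_N(ω)` for EVERY translation-invariant ground state `ω` of `Ψ_h` at EVERY `h > 0` and EVERY
`N ≥ 1`** — no special state is needed once the symmetry is explicitly broken: the floor (F) `(∂⁻E(h)/2)²` and
hubbard-cq-p6's response squeeze `m⋆ ≤ −∂⁻E(h)/2` (`dWaveOrderParameterTT'_le_neg_half_leftDeriv`). (At `h = 0`
only the quasi-average / gauge-averaged states are known to reach `(m⋆)²`: `DWaveSymmetricGroundStateLRO.lean`.)
[cite: Griffiths1966, §II] [cite: KomaTasaki1994, §1] -/
theorem sq_dWaveOrderParameterTT'_le_boxLRO (hh : 0 < h)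
    (hω : ω.IsMeanEnergyMinimiser (hubbardTTPrimeSourcedInteraction 1 t' U μ dWaveFormFactor h) 1)
    {N : ℕ} (hN : N ≠ 0) :
    dWaveOrderParameterTT' t' U μ ^ 2 ≤
      (((N : ℂ) ^ 4)⁻¹ * ∑ x ∈ halfOpenBox 2 N, ∑ y ∈ halfOpenBox 2 N, ω.dWavePairCorr x y).re := by
  have hm := TorusPairLROFixedSource.dWaveOrderParameterTT'_le_neg_half_leftDeriv t' U μ hh
  have hm0 := dWaveOrderParameterTT'_nonneg t' U μ
  calc dWaveOrderParameterTT' t' U μ ^ 2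
      ≤ (-derivWithin (dWaveSourceEnergyDensityTT' t' U μ) (Iio h) h / 2) ^ 2 := pow_le_pow_left₀ hm0 hm 2
    _ = (derivWithin (dWaveSourceEnergyDensityTT' t' U μ) (Iio h) h / 2) ^ 2 := by ring
    _ ≤ _ := hω.sq_half_leftDeriv_le_re_boxAverage_dWavePairCorr hh hN

/-- **THE INFINITE-VOLUME QUASI-AVERAGE IDENTITY** (uniform over ground states): `∀ ε > 0 ∃ h₀ > 0 ∀ h ∈ (0,h₀)`,
EVERY translation-invariant ground state `ω` of `Ψ_h` has, eventually in `N`,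
`(m⋆)² ≤ boxLRO_N(ω) ≤ (m⋆)² + ε` — `lim_{h→0⁺} limsup/liminf_N boxLRO_N = (m⋆)²` for every choice of sourced
ground states (the band edges `(∂^∓E(h)/2)²` both tend to `(m⋆)²`, hubbard-cq-p6's
`exists_forall_sq_half_derivs_mem`). The torus twin is `TorusPairLROFixedSource.exists_forall_eventually_abs_torusDiagonal_sub_sq_le`.
[cite: KomaTasaki1994, §1] [cite: KomaTasaki1993, Theorem 7.3] -/
theorem exists_forall_eventually_boxLRO_mem_Icc_sq_dWaveOrderParameterTT' (t' U μ : ℝ) {ε : ℝ} (hε : 0 < ε) :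
    ∃ h₀ : ℝ, 0 < h₀ ∧ ∀ h : ℝ, 0 < h → h < h₀ → ∀ ⦃ω : InfVolFermionState 2⦄,
      ω.IsMeanEnergyMinimiser (hubbardTTPrimeSourcedInteraction 1 t' U μ dWaveFormFactor h) 1 →
      ∀ᶠ N : ℕ in atTop,
        (((N : ℂ) ^ 4)⁻¹ * ∑ x ∈ halfOpenBox 2 N, ∑ y ∈ halfOpenBox 2 N, ω.dWavePairCorr x y).re ∈
          Set.Icc (dWaveOrderParameterTT' t' U μ ^ 2) (dWaveOrderParameterTT' t' U μ ^ 2 + ε) := by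
  obtain ⟨h₀, hh₀, hsq⟩ := TorusPairLROFixedSource.exists_forall_sq_half_derivs_mem t' U μ (half_pos hε)
  refine ⟨h₀, hh₀, fun h hh hhh ω hω => ?_⟩
  obtain ⟨-, -, h3⟩ := hsq h hh hhh
  filter_upwards [eventually_boxLRO_mem_Icc hh hω (half_pos hε), eventually_ne_atTop 0] with N hN hN0
  exact ⟨sq_dWaveOrderParameterTT'_le_boxLRO hh hω hN0, hN.2.trans (by linarith)⟩

/-- **`m⋆ > 0` ⇒ EVERY translation-invariant ground state at EVERY small positive field has `d`-wave ODLRO**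
(box pair LRO `≥ (m⋆)² > 0` in every box). [cite: KomaTasaki1994, §1] -/
theorem odlro_of_hasDWaveOrderTT' {t' U μ : ℝ} (hpos : HasDWaveOrderTT' t' U μ) (hh : 0 < h)
    (hω : ω.IsMeanEnergyMinimiser (hubbardTTPrimeSourcedInteraction 1 t' U μ dWaveFormFactor h) 1) :
    ∃ c : ℝ, 0 < c ∧ ∀ N : ℕ, N ≠ 0 →
      c ≤ (((N : ℂ) ^ 4)⁻¹ * ∑ x ∈ halfOpenBox 2 N, ∑ y ∈ halfOpenBox 2 N, ω.dWavePairCorr x y).re :=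
  ⟨dWaveOrderParameterTT' t' U μ ^ 2, pow_pos hpos 2, fun _ hN => sq_dWaveOrderParameterTT'_le_boxLRO hh hω hN⟩

end Summit.Ventures.CertifiedManyBodySolver.Observables.TIGroundStatePairLROBand

end
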